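import Mathlib.Data.ZMod.Basic
import Mathlib.Data.Fintype.Prod
import Mathlib.Algebra.BigOperators.Group.Finset.Basic
import Mathlib.Algebra.BigOperators.Ring.Finset
import Mathlib.FieldTheory.Finite.Basic
import Mathlib.Tactic.Ring
import Mathlib.Tactic.NormNum
import Mathlib.Tactic.Linarith
import HarnessLib

/-!
# BirchSwinnertonDyer — rank-2 `Ш[p^∞]` cell, STRUCTURE track: singular symmetric `2×2` matrices mod `p^k` — the finite identities behind
model S's LEVEL LAW (T31′, definition-free form)

HONEST FRAMING (cell `b2b-bsdr2sha`, run/shared/lean/b2b/bsd-rank2-sha/; STRUCTURE.md §2 C2 «model S = Haar measure on symmetric `2×2` matrices over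
`ℤ_p`», pre-registration P-046 «LEVEL LADDER» of LEAD g16, HOME/INBOX.md l.1306; LEAD g16's statement sheet HOME/structure/T31.Rank2ShaSymDetLevels.draft.lean
sha256 01addec9…, typed into the tree's conventions and extended by P2 g12; referee g27's independent derivation l.1308): COUNTING IDENTITIES MOD `p^k` ONLY;
nothing here is a statement about elliptic curves, regulators, heights, `Ш`, or BSD in rank ≥ 2.

DEFINITION-FREE FORM (LEAD g16 RULING (110)(iii), 2026-08-25): this file introduces NO definition; the two objects of the statement sheet appear as
explicit expressions — the count `N(m) := #{(a,b,c) ∈ (ℤ/m)³ : a·c = b²}` (singular symmetric `2×2` matrices `[[a,b],[b,c]]` mod `m`; under model S,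
`P(v_p(det) ≥ k) = N(p^k)/p^{3k}`) is written each time as the `Finset.card` of the filter of `(ZMod m)³` by `a*c = b^2`, and the closed form
`N_k(p) = (p^k − p^{k−1})·Σ_{j<⌈k/2⌉}(2j+1)(p^{k−j} − p^{k−j−1}) + p^{⌊k/2⌋}(k(p^k − p^{k−1}) + p^k)` (P-046 card; referee g27 independently) enters Part B as a
HYPOTHESIS `hN : ∀ k, N k = …` on an arbitrary function `N : ℕ → ℤ` (so the theorems hold for THE closed form and assert nothing else).

* Part A: kernel-checked counts (`decide`; `decide +kernel` for `m = 49`): level 1 (`p = 3,5,7,11,13`: `p²`), level 2 (`p = 3`: 99; `p = 5`: 725; `p = 7`: 2695),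
  level 3 (`p = 3`: 891); and the arithmetic of these values against the level formulas [`level_values_eq_closed`].
* Part B [`closedForm_levels`]: the closed form at `k = 1,2,3,4` for every `p`: `p²`, `p²(p²+p−1)`, `p⁴(p²+p−1)`, `p⁵(p³+p²−1)`, i.e. the LEVEL LAW
  `q₁ = 1/p`, `q₂ = (p²+p−1)/p⁴`, `q₃ = q₂/p` (EXACT THIN STEP `N₃ = p²·N₂`), `q₄ = (p³+p²−1)/p⁷`, as polynomial identities in `p`.
* Part C (P2 g12): **LEVEL 1 FOR EVERY PRIME** [`fibre_count`, `symdetCount_prime`]: over the field `𝔽_p`, for each `a` the number of `(b, c)` with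
  `ac = b²` is `p` (`a ≠ 0`: `c = a⁻¹b²` is determined by `b`; `a = 0`: `b = 0` and `c` is free), hence `#{(a,b,c) ∈ 𝔽_p³ : ac = b²} = p² = N₁(p)` —
  the law `q₁ = P_S(v ≥ 1) = 1/p` as a theorem, not a finite check.

NOT TYPED: the general level-`k` count `N(p^k) = N_k(p)` for `k ≥ 2` (a `p`-adic lifting count; only the instances of Part A), the Haar-measure
reading of these ratios, anything about which model governs certified regulators (that is P-046's empirical question), every census number. No named fact,
no axiom, no `sorry`. References: STRUCTURE.md §2 C2 and the P-046 card (LEAD g16, 2026-08-25); HOME/structure/T31.Rank2ShaSymDetLevels.draft.lean;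
the definition-carrying candidate 1be8c674… (referee GREEN R-283, LEAD GO l.1318) that this file replaces is kept at HOME/lean-p2/Rank2ShaSymDetLevels.green-candidate-1be8c674.lean.
-/

set_option autoImplicit false

-- single-conjunct summit: `Summit.BirchSwinnertonDyer.BirchSwinnertonDyer.…` repeats the name by design
set_option linter.dupNamespace false

namespace Summit.BirchSwinnertonDyer.BirchSwinnertonDyer.Rank2Sha.Structure.SymDetLevels

open Finset

/-! ## Part A — kernel-checked counts `N(m) = #{(a,b,c) ∈ (ℤ/m)³ : a·c = b²}` -/

/-- level 1 at `p = 3`: `N(3) = 9 = 3²`. -/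
theorem symdetCount_3 : (univ.filter (fun x : ZMod 3 × ZMod 3 × ZMod 3 => x.1 * x.2.2 = x.2.1 ^ 2)).card = 9 := by decide
/-- level 1 at `p = 5`: `N(5) = 25 = 5²`. -/
theorem symdetCount_5 : (univ.filter (fun x : ZMod 5 × ZMod 5 × ZMod 5 => x.1 * x.2.2 = x.2.1 ^ 2)).card = 25 := by decide
/-- level 1 at `p = 7`: `N(7) = 49 = 7²`. -/
theorem symdetCount_7 : (univ.filter (fun x : ZMod 7 × ZMod 7 × ZMod 7 => x.1 * x.2.2 = x.2.1 ^ 2)).card = 49 := by decide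
/-- level 2 at `p = 3`: `N(9) = 99 = 3²·(3²+3−1)`. -/
theorem symdetCount_9 : (univ.filter (fun x : ZMod 9 × ZMod 9 × ZMod 9 => x.1 * x.2.2 = x.2.1 ^ 2)).card = 99 := by decide
set_option maxRecDepth 200000 in
/-- level 1 at `p = 11`: `N(11) = 121 = 11²`. -/
theorem symdetCount_11 : (univ.filter (fun x : ZMod 11 × ZMod 11 × ZMod 11 => x.1 * x.2.2 = x.2.1 ^ 2)).card = 121 := by decide
set_option maxRecDepth 200000 in
/-- level 1 at `p = 13`: `N(13) = 169 = 13²`. -/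
theorem symdetCount_13 : (univ.filter (fun x : ZMod 13 × ZMod 13 × ZMod 13 => x.1 * x.2.2 = x.2.1 ^ 2)).card = 169 := by decide
set_option maxRecDepth 200000 in
/-- level 2 at `p = 5`: `N(25) = 725 = 5²·(5²+5−1)`, i.e. `P_S(v ≥ 2) = 725/5⁶ = 29/625` at `p = 5`. -/
theorem symdetCount_25 : (univ.filter (fun x : ZMod 25 × ZMod 25 × ZMod 25 => x.1 * x.2.2 = x.2.1 ^ 2)).card = 725 := by decide
set_option maxRecDepth 200000 in
/-- level 3 at `p = 3`: `N(27) = 891 = 3⁴·(3²+3−1)`. -/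
theorem symdetCount_27 : (univ.filter (fun x : ZMod 27 × ZMod 27 × ZMod 27 => x.1 * x.2.2 = x.2.1 ^ 2)).card = 891 := by decide
set_option maxRecDepth 200000 in
/-- level 2 at `p = 7`: `N(49) = 2695 = 7²·(7²+7−1)` (`117 649` triples; evaluated by the kernel: `decide +kernel`, no extra axiom). -/
theorem symdetCount_49 : (univ.filter (fun x : ZMod 49 × ZMod 49 × ZMod 49 => x.1 * x.2.2 = x.2.1 ^ 2)).card = 2695 := by
  decide +kernel

/-- the checked values ARE the level formulas at their points: `99 = N₂(3)`, `725 = N₂(5)`, `2695 = N₂(7)` with `N₂(p) = p²(p²+p−1)`, and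
`891 = N₃(3)` with `N₃(p) = p⁴(p²+p−1)` (plain arithmetic; combine with Part A and `closedForm_levels`). -/
theorem level_values_eq_closed :
    (99 : ℤ) = 3 ^ 2 * (3 ^ 2 + 3 - 1) ∧ (725 : ℤ) = 5 ^ 2 * (5 ^ 2 + 5 - 1) ∧ (2695 : ℤ) = 7 ^ 2 * (7 ^ 2 + 7 - 1) ∧
      (891 : ℤ) = 3 ^ 4 * (3 ^ 2 + 3 - 1) := by
  norm_num

/-! ## Part B — the closed form `N_k(p)` at levels 1–4 (polynomial identities, every `p`) -/

/-- **the LEVEL LAW from the closed form.** For every `p` and every function `N` given by the closed form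
`N k = (p^k − p^{k−1})·Σ_{j<⌈k/2⌉}(2j+1)(p^{k−j} − p^{k−j−1}) + p^{⌊k/2⌋}(k(p^k − p^{k−1}) + p^k)` (natural-number subtraction in the exponents and
integer division in the summation bound, exactly as printed): `N₁ = p²`, `N₂ = p²(p²+p−1)`, `N₃ = p⁴(p²+p−1)`, `N₄ = p⁵(p³+p²−1)`, and the EXACT THIN
STEP `N₃ = p²·N₂` (so `q₃ = q₂/p`). -/
theorem closedForm_levels (p : ℤ) (N : ℕ → ℤ)
    (hN : ∀ k : ℕ, N k = (p ^ k - p ^ (k - 1)) * ∑ j ∈ range ((k + 1) / 2), (2 * (j : ℤ) + 1) * (p ^ (k - j) - p ^ (k - j - 1))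
      + p ^ (k / 2) * ((k : ℤ) * (p ^ k - p ^ (k - 1)) + p ^ k)) :
    N 1 = p ^ 2 ∧ N 2 = p ^ 2 * (p ^ 2 + p - 1) ∧ N 3 = p ^ 4 * (p ^ 2 + p - 1) ∧ N 4 = p ^ 5 * (p ^ 3 + p ^ 2 - 1) ∧
      N 3 = p ^ 2 * N 2 := by
  refine ⟨?_, ?_, ?_, ?_, ?_⟩ <;> simp [hN, sum_range_succ] <;> ring

/-! ## Part C — level 1 for every prime: `#{ac = b²} = p²` over `𝔽_p` -/

/-- **the fibres over `a`**: in `𝔽_p`, for each `a` the number of `(b, c)` with `a·c = b²` is `p` — for `a ≠ 0` because `c = a⁻¹b²` is determined by the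
free `b`, for `a = 0` because `b² = 0` forces `b = 0` and leaves `c` free. -/
theorem fibre_count (p : ℕ) [Fact p.Prime] (a : ZMod p) :
    (∑ b : ZMod p, ∑ c : ZMod p, if a * c = b ^ 2 then (1 : ℕ) else 0) = p := by
  by_cases ha : a = 0
  · subst ha
    have h : ∀ b : ZMod p, (∑ c : ZMod p, if (0 : ZMod p) * c = b ^ 2 then (1 : ℕ) else 0) = if b = 0 then p else 0 := by
      intro b
      by_cases hb : b = 0
      · subst hb; simp [ZMod.card]
      · have : ¬ ((0 : ZMod p) = b ^ 2) := by
          intro h; exact hb (pow_eq_zero_iff two_ne_zero |>.mp h.symm)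
        simp [this, hb]
    simp_rw [h]
    simp
  · have h : ∀ b c : ZMod p, (a * c = b ^ 2) ↔ (c = a⁻¹ * b ^ 2) := by
      intro b c; rw [eq_inv_mul_iff_mul_eq₀ ha]
    simp_rw [h]
    simp [ZMod.card]

/-- **LEVEL 1 FOR EVERY PRIME**: `N(p) = #{(a,b,c) ∈ 𝔽_p³ : ac = b²} = p²` (`= N₁(p)` of `closedForm_levels`), i.e. `P_S(v_p(det) ≥ 1) = p²/p³ = 1/p`
under model S. -/
theorem symdetCount_prime (p : ℕ) [Fact p.Prime] :
    (univ.filter (fun x : ZMod p × ZMod p × ZMod p => x.1 * x.2.2 = x.2.1 ^ 2)).card = p ^ 2 := by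
  rw [card_filter, Fintype.sum_prod_type]
  simp_rw [Fintype.sum_prod_type, fibre_count]
  simp [ZMod.card, sq]

end Summit.BirchSwinnertonDyer.BirchSwinnertonDyer.Rank2Sha.Structure.SymDetLevels
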